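import Literature.Geometry.Riemannian.ExpMapIndexNonneg
import Literature.Geometry.Riemannian.ExpMapJacobiNondeg
import Literature.Geometry.Lorentzian.CurvatureSymmetries
import Literature.Geometry.Lorentzian.CovariantDerivAlongLinear
import HarnessLib

/-!
# `exp_p` has injective differential on the injectivity domain (Lee 2018, Thm. 10.34 (b) via
Thm. 10.26 and Prop. 10.20)

Layer 6g of the programme for `Literature.Geometry.Riemannian.lee_expMap_injectivityDomain`
(Lee 2018, Thm. 10.34): for a smooth connected-or-not complete Riemannian manifold, `p ∈ M` and
`v ∈ ID(p)`, the differential `d(exp_p)_v` is injective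
(`mfderiv_riemannianExpMap_injective_of_mem_injectivityDomain`). Lee: "`ID(p)` contains no
conjugate vectors (Thm. 10.26: a geodesic minimizing past a conjugate point is impossible), and
critical points of `exp_p` are conjugate vectors (Prop. 10.20)".

Proof (Lee 2018, proof of Thm. 10.26 with Prop. 10.20, energy version). Let `d(exp_p)_v(w) = 0`,
`w ≠ 0`, and let `γ = γ_v` minimize on `[0, s₀]`, `s₀ > 1`. The variation field
`J(t) = ∂_s|₀ exp_p(t(v + sw)) = d(exp_p)_{tv}(tw)` is a Jacobi field along `γ` with `J(0) = 0`,
`J(1) = 0` (`ExpMapJacobiField.lean`) and `D_tJ(1) ≠ 0` (`ExpMapJacobiNondeg.lean`). With the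
smooth function `φ(t) = -t(s₀ - t)/(s₀ - 1)` (`φ(0) = φ(s₀) = 0`, `φ(1) = -1`) put `W = φ D_tJ` and
consider the broken field `X₁ = J + εW` on `[0, 1]`, `X₂ = εW` on `[1, s₀]`. By
`index_nonneg_of_isMinimizingUpTo` (Cor. 10.23), `0 ≤ I(X₁) + I(X₂)`. Expanding (curvature pair
symmetry) and integrating by parts with the Jacobi equation and metric compatibility
(`(d/dt)[g(D_tJ, J) + 2ε g(D_tJ, W)] = I`-integrand of `X₁` minus `ε²` that of `W`, skew-adjointness
of `R`), `I(X₁) + I(X₂) = 2ε g(D_tJ(1), W(1)) + ε² C = -2ε |D_tJ(1)|² + ε² C`, which is negative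
for small `ε > 0` — contradiction. Hence `ker d(exp_p)_v = 0`.

No definitions, no named facts (D-0026).

## References

* J. M. Lee, *Introduction to Riemannian Manifolds*, 2nd ed. (2018), Prop. 10.20, Cor. 10.23,
  Thm. 10.26, Thm. 10.34. [LeeRiemannianManifolds2018]
* B. O'Neill, *Semi-Riemannian geometry* (1983), Ch. 10, Prop. 10, Thm. 17. [ONeill1983]
-/

noncomputable section

open Bundle Set Filter Function MeasureTheory
open scoped Manifold ContDiff Topology

namespace Literature.Geometry.Riemannian

open Literature.Geometry.Lorentzian
open Literature.Geometry.Lorentzian.PseudoRiemannianMetric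

variable {E : Type*} [NormedAddCommGroup E] [NormedSpace ℝ E] {H : Type*} [TopologicalSpace H]
  {I : ModelWithCorners ℝ E H} {M : Type*} [TopologicalSpace M] [ChartedSpace H M]
  [IsManifold I ∞ M] {n : ℕ∞ω} [FiniteDimensional ℝ E] [CompleteSpace E]
  (g : PseudoRiemannianMetric I n E (TangentSpace I : M → Type _)) [g.HasLeviCivita]
  [T2Space M] [BoundarylessManifold I M]
  [CovariantDerivative.ContMDiffCovariantDerivative g.leviCivita 1]

set_option synthInstance.maxHeartbeats 400000 in
/-- **Expansion of the index integrand of `J + εW`** (pure algebra: `R` trilinear, `G` bilinear,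
with the pair symmetry `G(R(W,T)J,T) = G(R(J,T)W,T)` and `G(W', J') = G(J', W')`):
`G(R(J+εW,T)(J+εW),T) + G(J'+εW',J'+εW') = [G(R(J,T)J,T) + G(J',J')] + 2ε[G(R(J,T)W,T) + G(J',W')]
 + ε²[G(R(W,T)W,T) + G(W',W')]` (Lee 2018, p. 304, bilinearity of the index form). [folklore] -/
theorem index_integrand_expand {F : Type*} [NormedAddCommGroup F] [NormedSpace ℝ F]
    (Rm : F →L[ℝ] F →L[ℝ] F →L[ℝ] F) (G : F →L[ℝ] F →L[ℝ] ℝ) (J W T Jp Wp : F) (ε : ℝ)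
    (hpair : G (Rm W T J) T = G (Rm J T W) T) (hsymm : G Wp Jp = G Jp Wp) :
    G (Rm (J + ε • W) T (J + ε • W)) T + G (Jp + ε • Wp) (Jp + ε • Wp) =
      (G (Rm J T J) T + G Jp Jp) + 2 * ε * (G (Rm J T W) T + G Jp Wp) +
        ε ^ 2 * (G (Rm W T W) T + G Wp Wp) := by
  simp only [map_add, map_smul, add_apply, smul_apply, smul_eq_mul]
  rw [hpair, hsymm]
  ring

set_option synthInstance.maxHeartbeats 400000 in
/-- **The index integrand of `εW` is `ε²` times that of `W`** (bilinearity). [folklore] -/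
theorem index_integrand_smul {F : Type*} [NormedAddCommGroup F] [NormedSpace ℝ F]
    (Rm : F →L[ℝ] F →L[ℝ] F →L[ℝ] F) (G : F →L[ℝ] F →L[ℝ] ℝ) (W T Wp : F) (ε : ℝ) :
    G (Rm (ε • W) T (ε • W)) T + G (ε • Wp) (ε • Wp) = ε ^ 2 * (G (Rm W T W) T + G Wp Wp) := by
  simp only [map_smul, smul_apply, smul_eq_mul]
  ring

set_option maxHeartbeats 1000000 in
/-- **`d(exp_p)_v` is injective for `v` in the injectivity domain** (Lee 2018, Thm. 10.34 (b):
"`exp_p|_{ID(p)}` is a diffeomorphism onto its image", whose differential part is Thm. 10.26 —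
no conjugate points before the cut point — combined with Prop. 10.20 — critical points of `exp_p`
are conjugate vectors). Smooth metric (`∞ ≤ n`), positive definite, complete Levi-Civita
connection; see the module docstring for the proof.
[cite: LeeRiemannianManifolds2018, Thm. 10.34 (b), Thm. 10.26, Prop. 10.20] -/
theorem mfderiv_riemannianExpMap_injective_of_mem_injectivityDomain (hn : (∞ : ℕ∞ω) ≤ n)
    (hg : g.IsRiemannian) (hc : IsGeodesicallyComplete g.leviCivita) (p : M)
    {v : TangentSpace I p} (hv : v ∈ injectivityDomain g hg p) :
    Injective (mfderiv 𝓘(ℝ, E) I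
      (fun w : E ↦ riemannianExpMap g p (show TangentSpace I p from w)) (show E from v)) := by
  haveI : Fact (1 ≤ n) := ⟨le_trans (by exact_mod_cast le_top) hn⟩
  haveI : CovariantDerivative.ContMDiffCovariantDerivative g.leviCivita ∞ :=
    contMDiffCovariantDerivative_leviCivita_infty g hn
  have hLC : g.IsLeviCivita g.leviCivita := isLeviCivita_leviCivita_holds (g := g)
  have htors : g.leviCivita.torsion = 0 := hLC.1
  have hcov₁ : g.leviCivita.IsLocallyContMDiff 1 :=
    g.isLocallyContMDiff_leviCivita_holds 1 (le_trans (by exact_mod_cast le_top) hn)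
  have hcovI : g.leviCivita.IsLocallyContMDiff ∞ :=
    g.isLocallyContMDiff_leviCivita_holds ⊤ (le_trans (by exact_mod_cast le_rfl) hn)
  have h2 : (2 : ℕ∞ω) ≤ ∞ := WithTop.coe_le_coe.2 le_top
  have h2n : (2 : ℕ∞ω) ≤ n := h2.trans hn
  show Injective (mfderiv 𝓘(ℝ, E) I
    (fun u : E ↦ expMap g.leviCivita p (show TangentSpace I p from u)) (show E from v))
  set L := mfderiv 𝓘(ℝ, E) I
    (fun u : E ↦ expMap g.leviCivita p (show TangentSpace I p from u)) (show E from v) with hL_def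
  -- it suffices to show that the kernel is trivial
  suffices hker : ∀ w : TangentSpace I p, L w = 0 → w = 0 by
    intro w₁ w₂ h12
    have h : L (w₁ - w₂) = 0 := by rw [map_sub, h12, sub_self]
    exact sub_eq_zero.1 (hker _ h)
  intro w hw
  by_contra hwne
  -- `γ_v` minimizes on `[0, s₀]`, `s₀ > 1`
  obtain ⟨s₀, hs₀, hmin⟩ := hv
  have hu : v + (0 : ℝ) • w = v := by rw [zero_smul, add_zero]
  have hmin' : IsMinimizingUpTo g hg p (v + (0 : ℝ) • w) s₀ := by
    rw [hu]
    exact hmin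
  -- the Jacobi field `J` along `γ(t) = exp_p(t(v + 0w))`, its derivative `J'`
  obtain ⟨J, hJ_def⟩ : ∃ J : Π t : ℝ, TangentSpace I (expMap g.leviCivita p (t • (v + (0 : ℝ) • w))),
      J = fun t ↦ velocity I (fun s : ℝ ↦ expMap g.leviCivita p (t • (v + s • w))) 0 := ⟨_, rfl⟩
  obtain ⟨J', hJ'_def⟩ : ∃ J' : Π t : ℝ, TangentSpace I (expMap g.leviCivita p (t • (v + (0 : ℝ) • w))), J' = fun t ↦ (covariantDerivAlong g.leviCivita (fun t : ℝ ↦ expMap g.leviCivita p (t • (v + (0 : ℝ) • w))) J t) :=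
    ⟨_, rfl⟩
  have hJ't : ∀ t, (covariantDerivAlong g.leviCivita (fun t : ℝ ↦ expMap g.leviCivita p (t • (v + (0 : ℝ) • w))) J t) = J' t := fun t ↦ by rw [hJ'_def]
  have hΓ : ContMDiff (𝓘(ℝ, ℝ).prod 𝓘(ℝ, ℝ)) I ∞
      (uncurry fun (t : ℝ) (s : ℝ) ↦ expMap g.leviCivita p (t • (v + s • w))) :=
    contMDiff_uncurry_expVariation hc p v w
  have hswap : ContMDiff (𝓘(ℝ, ℝ).prod 𝓘(ℝ, ℝ)) (𝓘(ℝ, ℝ).prod 𝓘(ℝ, ℝ)) ∞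
      (fun q : ℝ × ℝ ↦ ((q.2, q.1) : ℝ × ℝ)) := contMDiff_snd.prodMk contMDiff_fst
  have hSall : ContMDiff (𝓘(ℝ, ℝ).prod 𝓘(ℝ, ℝ)) I.tangent ∞ (fun q : ℝ × ℝ ↦
      (TotalSpace.mk' E (expMap g.leviCivita p (q.1 • (v + q.2 • w)))
        (velocity I (fun s : ℝ ↦ expMap g.leviCivita p (q.1 • (v + s • w))) q.2) :
          TangentBundle I M)) := by
    have h' : ContMDiff (𝓘(ℝ, ℝ).prod 𝓘(ℝ, ℝ)) I ∞
        (uncurry fun (s : ℝ) (t : ℝ) ↦ expMap g.leviCivita p (t • (v + s • w))) := hΓ.comp hswap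
    exact (contMDiff_lift_velocity_uncurry_left h').comp hswap
  have hline0 : ContMDiff 𝓘(ℝ, ℝ) (𝓘(ℝ, ℝ).prod 𝓘(ℝ, ℝ)) ∞ (fun t : ℝ ↦ ((t, (0 : ℝ)) : ℝ × ℝ)) :=
    contMDiff_id.prodMk contMDiff_const
  have hJl : ContMDiff 𝓘(ℝ, ℝ) I.tangent ∞ (fun t ↦ (TotalSpace.mk' E (expMap g.leviCivita p (t • (v + (0 : ℝ) • w))) (J t) : TangentBundle I M)) := by
    rw [hJ_def]
    exact hSall.comp hline0
  have hJ'l : ContMDiff 𝓘(ℝ, ℝ) I.tangent ∞ (fun t ↦ (TotalSpace.mk' E (expMap g.leviCivita p (t • (v + (0 : ℝ) • w))) (J' t) : TangentBundle I M)) := by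
    rw [hJ'_def]
    exact contMDiff_lift_covariantDerivAlong_of_lift hcovI hJl
  have hgeo : IsGeodesic g.leviCivita (fun t : ℝ ↦ expMap g.leviCivita p (t • (v + (0 : ℝ) • w))) := isGeodesic_expVariation hc p v w 0
  have hγsm : ContMDiff 𝓘(ℝ, ℝ) I ∞ (fun t : ℝ ↦ expMap g.leviCivita p (t • (v + (0 : ℝ) • w))) := fun t ↦ (contMDiffAt_totalSpace.1 (hJl t)).1
  have hTl : ContMDiff 𝓘(ℝ, ℝ) I.tangent ∞ (fun t ↦ (TotalSpace.mk' E (expMap g.leviCivita p (t • (v + (0 : ℝ) • w))) ((velocity I (fun t : ℝ ↦ expMap g.leviCivita p (t • (v + (0 : ℝ) • w))) t)) : TangentBundle I M)) := contMDiff_lift_velocity_of_contMDiff hγsm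
  -- `J(0) = 0`, `J(1) = d(exp_p)_v(w) = 0`, hence `J'(1) ≠ 0`
  have hJ0 : J 0 = 0 := by
    rw [hJ_def]
    exact velocity_expVariation_zero (cov := g.leviCivita) p v w 0
  have hJ1 : J 1 = 0 := by
    rw [hJ_def]
    show velocity I (fun s' : ℝ ↦ expMap g.leviCivita p ((1 : ℝ) • (v + s' • w))) 0 = 0
    rw [velocity_expVariation_eq_mfderiv_expMap hc p v w 1]
    have e1 : ((1 : ℝ) • (show E from v)) = (show E from v) := one_smul ℝ _
    have e2 : ((1 : ℝ) • (show E from w)) = (show E from w) := one_smul ℝ _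
    rw [e1, e2]
    exact hw
  have hjac : ∀ t, (covariantDerivAlong g.leviCivita (fun t : ℝ ↦ expMap g.leviCivita p (t • (v + (0 : ℝ) • w))) J' t) + (g.leviCivita.curvature (expMap g.leviCivita p (t • (v + (0 : ℝ) • w))) (J t) (velocity I (fun t : ℝ ↦ expMap g.leviCivita p (t • (v + (0 : ℝ) • w))) t) (velocity I (fun t : ℝ ↦ expMap g.leviCivita p (t • (v + (0 : ℝ) • w))) t)) = 0 := by
    intro t
    rw [hJ'_def, hJ_def]
    exact jacobi_expVariation hcov₁ htors hc p v w 0 t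
  have hJ'1 : J' 1 ≠ 0 := by
    intro h
    have hJ1e := hJ1
    have he := h
    rw [hJ_def] at hJ1e
    rw [hJ'_def, hJ_def] at he
    exact hwne (eq_zero_of_velocity_eq_zero_of_covariantDerivAlong_eq_zero htors hc p v w
      zero_le_one hJ1e he)
  -- the auxiliary field `W = φ J'`
  obtain ⟨φ, hφ_def⟩ : ∃ φ : ℝ → ℝ, φ = fun t ↦ -(t * (s₀ - t)) / (s₀ - 1) := ⟨_, rfl⟩
  have hφ : ContMDiff 𝓘(ℝ, ℝ) 𝓘(ℝ, ℝ) ∞ φ := by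
    rw [hφ_def]
    exact ((contDiff_id.mul (contDiff_const.sub contDiff_id)).neg.div_const _).contMDiff
  have hs₀1 : s₀ - 1 ≠ 0 := sub_ne_zero.2 (ne_of_gt hs₀)
  have hφ0 : φ 0 = 0 := by
    rw [hφ_def]
    show -(0 * (s₀ - 0)) / (s₀ - 1) = 0
    ring
  have hφ1 : φ 1 = -1 := by
    rw [hφ_def]
    show -(1 * (s₀ - 1)) / (s₀ - 1) = -1
    rw [one_mul, neg_div, div_self hs₀1]
  have hφs : φ s₀ = 0 := by
    rw [hφ_def]
    show -(s₀ * (s₀ - s₀)) / (s₀ - 1) = 0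
    ring
  obtain ⟨W, hW_def⟩ : ∃ W : Π t : ℝ, TangentSpace I (expMap g.leviCivita p (t • (v + (0 : ℝ) • w))), W = fun t ↦ φ t • J' t := ⟨_, rfl⟩
  have hWl : ContMDiff 𝓘(ℝ, ℝ) I.tangent ∞ (fun t ↦ (TotalSpace.mk' E (expMap g.leviCivita p (t • (v + (0 : ℝ) • w))) (W t) : TangentBundle I M)) := by
    rw [hW_def]
    exact contMDiff_liftAlong_smul hJ'l hφ
  have hW'l : ContMDiff 𝓘(ℝ, ℝ) I.tangent ∞ (fun t ↦ (TotalSpace.mk' E (expMap g.leviCivita p (t • (v + (0 : ℝ) • w))) ((covariantDerivAlong g.leviCivita (fun t : ℝ ↦ expMap g.leviCivita p (t • (v + (0 : ℝ) • w))) W t)) : TangentBundle I M)) :=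
    contMDiff_lift_covariantDerivAlong_of_lift hcovI hWl
  have hW0 : W 0 = 0 := by
    rw [hW_def]
    show φ 0 • J' 0 = 0
    rw [hφ0]
    exact zero_smul ℝ (J' 0)
  have hW1 : W 1 = -J' 1 := by
    rw [hW_def]
    show φ 1 • J' 1 = -J' 1
    rw [hφ1]
    exact neg_one_smul ℝ (J' 1)
  have hWs : W s₀ = 0 := by
    rw [hW_def]
    show φ s₀ • J' s₀ = 0
    rw [hφs]
    exact zero_smul ℝ (J' s₀)
  -- continuity of the index integrand of `W`, and the constants of the problem
  obtain ⟨hqW, -⟩ := integral_energy_le_taylor g hn hc hWl (zero_le_one (α := ℝ))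
  have hN : 0 < g.val (expMap g.leviCivita p ((1 : ℝ) • (v + (0 : ℝ) • w))) (J' 1) (J' 1) := hg _ _ hJ'1
  obtain ⟨ε, hε_def⟩ : ∃ ε : ℝ, ε = g.val (expMap g.leviCivita p ((1 : ℝ) • (v + (0 : ℝ) • w))) (J' 1) (J' 1) /
      (|(∫ t in (0 : ℝ)..1, (g.val (expMap g.leviCivita p (t • (v + (0 : ℝ) • w))) (g.leviCivita.curvature (expMap g.leviCivita p (t • (v + (0 : ℝ) • w))) (W t) (velocity I (fun t : ℝ ↦ expMap g.leviCivita p (t • (v + (0 : ℝ) • w))) t) (W t)) (velocity I (fun t : ℝ ↦ expMap g.leviCivita p (t • (v + (0 : ℝ) • w))) t) +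
          g.val (expMap g.leviCivita p (t • (v + (0 : ℝ) • w))) (covariantDerivAlong g.leviCivita (fun t : ℝ ↦ expMap g.leviCivita p (t • (v + (0 : ℝ) • w))) W t) (covariantDerivAlong g.leviCivita (fun t : ℝ ↦ expMap g.leviCivita p (t • (v + (0 : ℝ) • w))) W t))) +
        ∫ t in (1 : ℝ)..s₀, (g.val (expMap g.leviCivita p (t • (v + (0 : ℝ) • w))) (g.leviCivita.curvature (expMap g.leviCivita p (t • (v + (0 : ℝ) • w))) (W t) (velocity I (fun t : ℝ ↦ expMap g.leviCivita p (t • (v + (0 : ℝ) • w))) t) (W t)) (velocity I (fun t : ℝ ↦ expMap g.leviCivita p (t • (v + (0 : ℝ) • w))) t) +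
          g.val (expMap g.leviCivita p (t • (v + (0 : ℝ) • w))) (covariantDerivAlong g.leviCivita (fun t : ℝ ↦ expMap g.leviCivita p (t • (v + (0 : ℝ) • w))) W t) (covariantDerivAlong g.leviCivita (fun t : ℝ ↦ expMap g.leviCivita p (t • (v + (0 : ℝ) • w))) W t))| + g.val (expMap g.leviCivita p ((1 : ℝ) • (v + (0 : ℝ) • w))) (J' 1) (J' 1)) := ⟨_, rfl⟩
  have hden : 0 < |(∫ t in (0 : ℝ)..1, (g.val (expMap g.leviCivita p (t • (v + (0 : ℝ) • w))) (g.leviCivita.curvature (expMap g.leviCivita p (t • (v + (0 : ℝ) • w))) (W t) (velocity I (fun t : ℝ ↦ expMap g.leviCivita p (t • (v + (0 : ℝ) • w))) t) (W t)) (velocity I (fun t : ℝ ↦ expMap g.leviCivita p (t • (v + (0 : ℝ) • w))) t) +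
          g.val (expMap g.leviCivita p (t • (v + (0 : ℝ) • w))) (covariantDerivAlong g.leviCivita (fun t : ℝ ↦ expMap g.leviCivita p (t • (v + (0 : ℝ) • w))) W t) (covariantDerivAlong g.leviCivita (fun t : ℝ ↦ expMap g.leviCivita p (t • (v + (0 : ℝ) • w))) W t))) +
        ∫ t in (1 : ℝ)..s₀, (g.val (expMap g.leviCivita p (t • (v + (0 : ℝ) • w))) (g.leviCivita.curvature (expMap g.leviCivita p (t • (v + (0 : ℝ) • w))) (W t) (velocity I (fun t : ℝ ↦ expMap g.leviCivita p (t • (v + (0 : ℝ) • w))) t) (W t)) (velocity I (fun t : ℝ ↦ expMap g.leviCivita p (t • (v + (0 : ℝ) • w))) t) +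
          g.val (expMap g.leviCivita p (t • (v + (0 : ℝ) • w))) (covariantDerivAlong g.leviCivita (fun t : ℝ ↦ expMap g.leviCivita p (t • (v + (0 : ℝ) • w))) W t) (covariantDerivAlong g.leviCivita (fun t : ℝ ↦ expMap g.leviCivita p (t • (v + (0 : ℝ) • w))) W t))| + g.val (expMap g.leviCivita p ((1 : ℝ) • (v + (0 : ℝ) • w))) (J' 1) (J' 1) :=
    add_pos_of_nonneg_of_pos (abs_nonneg _) hN
  have hε : 0 < ε := by
    rw [hε_def]
    exact div_pos hN hden
  -- the broken field `X₁ = J + εW`, `X₂ = εW` and the nonnegativity of its index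
  have hεWl : ContMDiff 𝓘(ℝ, ℝ) I.tangent ∞ (fun t ↦ (TotalSpace.mk' E (expMap g.leviCivita p (t • (v + (0 : ℝ) • w))) (ε • W t) : TangentBundle I M)) :=
    contMDiff_liftAlong_smul hWl contMDiff_const
  have hX₁l : ContMDiff 𝓘(ℝ, ℝ) I.tangent ∞ (fun t ↦ (TotalSpace.mk' E (expMap g.leviCivita p (t • (v + (0 : ℝ) • w))) (J t + ε • W t) : TangentBundle I M)) :=
    contMDiff_liftAlong_add hJl hεWl
  have h0' : J 0 + ε • W 0 = 0 := by rw [hJ0, hW0, smul_zero, add_zero]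
  have h1' : J 1 + ε • W 1 = ε • W 1 := by rw [hJ1, zero_add]
  have hs' : ε • W s₀ = 0 := by rw [hWs, smul_zero]
  have hind := index_nonneg_of_isMinimizingUpTo g hn hg hc p (v + (0 : ℝ) • w) hs₀ hmin'
    (X₁ := (fun t ↦ J t + ε • W t)) (X₂ := (fun t ↦ ε • W t)) hX₁l hεWl h0' h1' hs'
  obtain ⟨hq₁, -⟩ := integral_energy_le_taylor g hn hc hX₁l (zero_le_one (α := ℝ))
  -- differentiability of the lifts
  have hJd : ∀ t, MDifferentiableAt 𝓘(ℝ, ℝ) I.tangent (fun t ↦ (TotalSpace.mk' E (expMap g.leviCivita p (t • (v + (0 : ℝ) • w))) (J t) : TangentBundle I M)) t :=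
    fun t ↦ (hJl t).mdifferentiableAt (by simp)
  have hJ'd : ∀ t, MDifferentiableAt 𝓘(ℝ, ℝ) I.tangent (fun t ↦ (TotalSpace.mk' E (expMap g.leviCivita p (t • (v + (0 : ℝ) • w))) (J' t) : TangentBundle I M)) t :=
    fun t ↦ (hJ'l t).mdifferentiableAt (by simp)
  have hWd : ∀ t, MDifferentiableAt 𝓘(ℝ, ℝ) I.tangent (fun t ↦ (TotalSpace.mk' E (expMap g.leviCivita p (t • (v + (0 : ℝ) • w))) (W t) : TangentBundle I M)) t :=
    fun t ↦ (hWl t).mdifferentiableAt (by simp)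
  have hW'd : ∀ t, MDifferentiableAt 𝓘(ℝ, ℝ) I.tangent (fun t ↦ (TotalSpace.mk' E (expMap g.leviCivita p (t • (v + (0 : ℝ) • w))) ((covariantDerivAlong g.leviCivita (fun t : ℝ ↦ expMap g.leviCivita p (t • (v + (0 : ℝ) • w))) W t)) : TangentBundle I M)) t :=
    fun t ↦ (hW'l t).mdifferentiableAt (by simp)
  have hεWd : ∀ t, MDifferentiableAt 𝓘(ℝ, ℝ) I.tangent (fun t ↦ (TotalSpace.mk' E (expMap g.leviCivita p (t • (v + (0 : ℝ) • w))) (ε • W t) : TangentBundle I M)) t :=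
    fun t ↦ (hεWl t).mdifferentiableAt (by simp)
  -- `D_t(εW) = ε D_tW`, `D_t(J + εW) = J' + ε D_tW`
  have hDεW : ∀ t, (covariantDerivAlong g.leviCivita (fun t : ℝ ↦ expMap g.leviCivita p (t • (v + (0 : ℝ) • w))) (fun t ↦ ε • W t) t) = ε • (covariantDerivAlong g.leviCivita (fun t : ℝ ↦ expMap g.leviCivita p (t • (v + (0 : ℝ) • w))) W t) := by
    intro t
    have h := covariantDerivAlong_smul_holds (cov := g.leviCivita) (γ := (fun t : ℝ ↦ expMap g.leviCivita p (t • (v + (0 : ℝ) • w)))) (W := W)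
      (f := fun _ : ℝ ↦ ε) (t₀ := t) (differentiableAt_const _) (hWd t)
    have h0 : deriv (fun _ : ℝ ↦ ε) t • W t = 0 := by
      rw [deriv_const]
      exact zero_smul ℝ (W t)
    rw [h0, zero_add] at h
    exact h
  have hDX₁ : ∀ t, (covariantDerivAlong g.leviCivita (fun t : ℝ ↦ expMap g.leviCivita p (t • (v + (0 : ℝ) • w))) (fun t ↦ J t + ε • W t) t) = J' t + ε • (covariantDerivAlong g.leviCivita (fun t : ℝ ↦ expMap g.leviCivita p (t • (v + (0 : ℝ) • w))) W t) := by
    intro t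
    rw [covariantDerivAlong_add_holds (cov := g.leviCivita) (hJd t) (hεWd t), hDεW t, hJ't t]
  -- pointwise expansion of the index integrands
  have hpair : ∀ t, g.val (expMap g.leviCivita p (t • (v + (0 : ℝ) • w))) (g.leviCivita.curvature (expMap g.leviCivita p (t • (v + (0 : ℝ) • w))) (W t) (velocity I (fun t : ℝ ↦ expMap g.leviCivita p (t • (v + (0 : ℝ) • w))) t) (J t)) (velocity I (fun t : ℝ ↦ expMap g.leviCivita p (t • (v + (0 : ℝ) • w))) t) =
      g.val (expMap g.leviCivita p (t • (v + (0 : ℝ) • w))) (g.leviCivita.curvature (expMap g.leviCivita p (t • (v + (0 : ℝ) • w))) (J t) (velocity I (fun t : ℝ ↦ expMap g.leviCivita p (t • (v + (0 : ℝ) • w))) t) (W t)) (velocity I (fun t : ℝ ↦ expMap g.leviCivita p (t • (v + (0 : ℝ) • w))) t) := fun t ↦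
    val_curvature_pair_symm hLC.2 hcov₁ htors h2n (expMap g.leviCivita p (t • (v + (0 : ℝ) • w))) (W t) (velocity I (fun t : ℝ ↦ expMap g.leviCivita p (t • (v + (0 : ℝ) • w))) t) (J t) (velocity I (fun t : ℝ ↦ expMap g.leviCivita p (t • (v + (0 : ℝ) • w))) t)
  have hsymm : ∀ t, g.val (expMap g.leviCivita p (t • (v + (0 : ℝ) • w))) (covariantDerivAlong g.leviCivita (fun t : ℝ ↦ expMap g.leviCivita p (t • (v + (0 : ℝ) • w))) W t) (J' t) = g.val (expMap g.leviCivita p (t • (v + (0 : ℝ) • w))) (J' t) (covariantDerivAlong g.leviCivita (fun t : ℝ ↦ expMap g.leviCivita p (t • (v + (0 : ℝ) • w))) W t) :=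
    fun t ↦ g.symm (expMap g.leviCivita p (t • (v + (0 : ℝ) • w))) (covariantDerivAlong g.leviCivita (fun t : ℝ ↦ expMap g.leviCivita p (t • (v + (0 : ℝ) • w))) W t) (J' t)
  have hpt1 : ∀ t, (g.val (expMap g.leviCivita p (t • (v + (0 : ℝ) • w))) (g.leviCivita.curvature (expMap g.leviCivita p (t • (v + (0 : ℝ) • w))) (J t + ε • W t) (velocity I (fun t : ℝ ↦ expMap g.leviCivita p (t • (v + (0 : ℝ) • w))) t) (J t + ε • W t)) (velocity I (fun t : ℝ ↦ expMap g.leviCivita p (t • (v + (0 : ℝ) • w))) t) +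
          g.val (expMap g.leviCivita p (t • (v + (0 : ℝ) • w))) (covariantDerivAlong g.leviCivita (fun t : ℝ ↦ expMap g.leviCivita p (t • (v + (0 : ℝ) • w))) (fun t ↦ J t + ε • W t) t) (covariantDerivAlong g.leviCivita (fun t : ℝ ↦ expMap g.leviCivita p (t • (v + (0 : ℝ) • w))) (fun t ↦ J t + ε • W t) t)) =
      (g.val (expMap g.leviCivita p (t • (v + (0 : ℝ) • w))) (g.leviCivita.curvature (expMap g.leviCivita p (t • (v + (0 : ℝ) • w))) (J t) (velocity I (fun t : ℝ ↦ expMap g.leviCivita p (t • (v + (0 : ℝ) • w))) t) (J t)) (velocity I (fun t : ℝ ↦ expMap g.leviCivita p (t • (v + (0 : ℝ) • w))) t) + g.val (expMap g.leviCivita p (t • (v + (0 : ℝ) • w))) (J' t) (J' t)) + 2 * ε * (g.val (expMap g.leviCivita p (t • (v + (0 : ℝ) • w))) (g.leviCivita.curvature (expMap g.leviCivita p (t • (v + (0 : ℝ) • w))) (J t) (velocity I (fun t : ℝ ↦ expMap g.leviCivita p (t • (v + (0 : ℝ) • w))) t) (W t)) (velocity I (fun t : ℝ ↦ expMap g.leviCivita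 p (t • (v + (0 : ℝ) • w))) t) + g.val (expMap g.leviCivita p (t • (v + (0 : ℝ) • w))) (J' t) (covariantDerivAlong g.leviCivita (fun t : ℝ ↦ expMap g.leviCivita p (t • (v + (0 : ℝ) • w))) W t)) + ε ^ 2 * (g.val (expMap g.leviCivita p (t • (v + (0 : ℝ) • w))) (g.leviCivita.curvature (expMap g.leviCivita p (t • (v + (0 : ℝ) • w))) (W t) (velocity I (fun t : ℝ ↦ expMap g.leviCivita p (t • (v + (0 : ℝ) • w))) t) (W t)) (velocity I (fun t : ℝ ↦ expMap g.leviCivita p (t • (v + (0 : ℝ) • w))) t) +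
          g.val (expMap g.leviCivita p (t • (v + (0 : ℝ) • w))) (covariantDerivAlong g.leviCivita (fun t : ℝ ↦ expMap g.leviCivita p (t • (v + (0 : ℝ) • w))) W t) (covariantDerivAlong g.leviCivita (fun t : ℝ ↦ expMap g.leviCivita p (t • (v + (0 : ℝ) • w))) W t)) := by
    intro t
    rw [hDX₁ t]
    exact index_integrand_expand (F := E) (g.leviCivita.curvature (expMap g.leviCivita p (t • (v + (0 : ℝ) • w)))) (g.val (expMap g.leviCivita p (t • (v + (0 : ℝ) • w)))) (J t) (W t)
      (velocity I (fun t : ℝ ↦ expMap g.leviCivita p (t • (v + (0 : ℝ) • w))) t) (J' t) (covariantDerivAlong g.leviCivita (fun t : ℝ ↦ expMap g.leviCivita p (t • (v + (0 : ℝ) • w))) W t) ε (hpair t) (hsymm t)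
  have hpt2 : ∀ t, (g.val (expMap g.leviCivita p (t • (v + (0 : ℝ) • w))) (g.leviCivita.curvature (expMap g.leviCivita p (t • (v + (0 : ℝ) • w))) (ε • W t) (velocity I (fun t : ℝ ↦ expMap g.leviCivita p (t • (v + (0 : ℝ) • w))) t) (ε • W t)) (velocity I (fun t : ℝ ↦ expMap g.leviCivita p (t • (v + (0 : ℝ) • w))) t) +
          g.val (expMap g.leviCivita p (t • (v + (0 : ℝ) • w))) (covariantDerivAlong g.leviCivita (fun t : ℝ ↦ expMap g.leviCivita p (t • (v + (0 : ℝ) • w))) (fun t ↦ ε • W t) t) (covariantDerivAlong g.leviCivita (fun t : ℝ ↦ expMap g.leviCivita p (t • (v + (0 : ℝ) • w))) (fun t ↦ ε • W t) t)) = ε ^ 2 * (g.val (expMap g.leviCivita p (t • (v + (0 : ℝ) • w))) (g.leviCivita.curvature (expMap g.leviCivita p (t • (v + (0 : ℝ) • w))) (W t) (velocity I (fun t : ℝ ↦ expMap g.leviCivita p (t • (v + (0 : ℝ) • w))) t) (W t)) (velocity I (fun t : ℝ ↦ expMap g.leviCivita p (t • (v + (0 : ℝ) • w))) t) +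
          g.val (expMap g.leviCivita p (t • (v + (0 : ℝ) • w))) (covariantDerivAlong g.leviCivita (fun t : ℝ ↦ expMap g.leviCivita p (t • (v + (0 : ℝ) • w))) W t) (covariantDerivAlong g.leviCivita (fun t : ℝ ↦ expMap g.leviCivita p (t • (v + (0 : ℝ) • w))) W t)) := by
    intro t
    rw [hDεW t]
    exact index_integrand_smul (F := E) (g.leviCivita.curvature (expMap g.leviCivita p (t • (v + (0 : ℝ) • w)))) (g.val (expMap g.leviCivita p (t • (v + (0 : ℝ) • w)))) (W t) (velocity I (fun t : ℝ ↦ expMap g.leviCivita p (t • (v + (0 : ℝ) • w))) t)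
      (covariantDerivAlong g.leviCivita (fun t : ℝ ↦ expMap g.leviCivita p (t • (v + (0 : ℝ) • w))) W t) ε
  -- the Jacobi equation turns `g(J'', ·)` into curvature terms
  have hJ'' : ∀ t, (covariantDerivAlong g.leviCivita (fun t : ℝ ↦ expMap g.leviCivita p (t • (v + (0 : ℝ) • w))) J' t) = -(g.leviCivita.curvature (expMap g.leviCivita p (t • (v + (0 : ℝ) • w))) (J t) (velocity I (fun t : ℝ ↦ expMap g.leviCivita p (t • (v + (0 : ℝ) • w))) t) (velocity I (fun t : ℝ ↦ expMap g.leviCivita p (t • (v + (0 : ℝ) • w))) t)) :=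
    fun t ↦ eq_neg_of_add_eq_zero_left (hjac t)
  have hJ''J : ∀ t, g.val (expMap g.leviCivita p (t • (v + (0 : ℝ) • w))) (covariantDerivAlong g.leviCivita (fun t : ℝ ↦ expMap g.leviCivita p (t • (v + (0 : ℝ) • w))) J' t) (J t) = g.val (expMap g.leviCivita p (t • (v + (0 : ℝ) • w))) (g.leviCivita.curvature (expMap g.leviCivita p (t • (v + (0 : ℝ) • w))) (J t) (velocity I (fun t : ℝ ↦ expMap g.leviCivita p (t • (v + (0 : ℝ) • w))) t) (J t)) (velocity I (fun t : ℝ ↦ expMap g.leviCivita p (t • (v + (0 : ℝ) • w))) t) := by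
    intro t
    have hsk := val_curvature_skew hLC.2 hcov₁ h2n (expMap g.leviCivita p (t • (v + (0 : ℝ) • w))) (J t) (velocity I (fun t : ℝ ↦ expMap g.leviCivita p (t • (v + (0 : ℝ) • w))) t) (velocity I (fun t : ℝ ↦ expMap g.leviCivita p (t • (v + (0 : ℝ) • w))) t) (J t)
    rw [hJ'' t, (g.val (expMap g.leviCivita p (t • (v + (0 : ℝ) • w)))).map_neg₂ (g.leviCivita.curvature (expMap g.leviCivita p (t • (v + (0 : ℝ) • w))) (J t) (velocity I (fun t : ℝ ↦ expMap g.leviCivita p (t • (v + (0 : ℝ) • w))) t) (velocity I (fun t : ℝ ↦ expMap g.leviCivita p (t • (v + (0 : ℝ) • w))) t)) (J t), hsk, neg_neg]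
  have hJ''W : ∀ t, g.val (expMap g.leviCivita p (t • (v + (0 : ℝ) • w))) (covariantDerivAlong g.leviCivita (fun t : ℝ ↦ expMap g.leviCivita p (t • (v + (0 : ℝ) • w))) J' t) (W t) = g.val (expMap g.leviCivita p (t • (v + (0 : ℝ) • w))) (g.leviCivita.curvature (expMap g.leviCivita p (t • (v + (0 : ℝ) • w))) (J t) (velocity I (fun t : ℝ ↦ expMap g.leviCivita p (t • (v + (0 : ℝ) • w))) t) (W t)) (velocity I (fun t : ℝ ↦ expMap g.leviCivita p (t • (v + (0 : ℝ) • w))) t) := by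
    intro t
    have hsk := val_curvature_skew hLC.2 hcov₁ h2n (expMap g.leviCivita p (t • (v + (0 : ℝ) • w))) (J t) (velocity I (fun t : ℝ ↦ expMap g.leviCivita p (t • (v + (0 : ℝ) • w))) t) (velocity I (fun t : ℝ ↦ expMap g.leviCivita p (t • (v + (0 : ℝ) • w))) t) (W t)
    rw [hJ'' t, (g.val (expMap g.leviCivita p (t • (v + (0 : ℝ) • w)))).map_neg₂ (g.leviCivita.curvature (expMap g.leviCivita p (t • (v + (0 : ℝ) • w))) (J t) (velocity I (fun t : ℝ ↦ expMap g.leviCivita p (t • (v + (0 : ℝ) • w))) t) (velocity I (fun t : ℝ ↦ expMap g.leviCivita p (t • (v + (0 : ℝ) • w))) t)) (W t), hsk, neg_neg]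
  -- `G(t) = g(J', J) + 2ε g(J', W)` has derivative `q₁ - ε² q_W`
  have hG : ∀ t, HasDerivAt (fun t ↦ g.val (expMap g.leviCivita p (t • (v + (0 : ℝ) • w))) (J' t) (J t) + 2 * ε * g.val (expMap g.leviCivita p (t • (v + (0 : ℝ) • w))) (J' t) (W t))
      ((g.val (expMap g.leviCivita p (t • (v + (0 : ℝ) • w))) (g.leviCivita.curvature (expMap g.leviCivita p (t • (v + (0 : ℝ) • w))) (J t + ε • W t) (velocity I (fun t : ℝ ↦ expMap g.leviCivita p (t • (v + (0 : ℝ) • w))) t) (J t + ε • W t)) (velocity I (fun t : ℝ ↦ expMap g.leviCivita p (t • (v + (0 : ℝ) • w))) t) +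
          g.val (expMap g.leviCivita p (t • (v + (0 : ℝ) • w))) (covariantDerivAlong g.leviCivita (fun t : ℝ ↦ expMap g.leviCivita p (t • (v + (0 : ℝ) • w))) (fun t ↦ J t + ε • W t) t) (covariantDerivAlong g.leviCivita (fun t : ℝ ↦ expMap g.leviCivita p (t • (v + (0 : ℝ) • w))) (fun t ↦ J t + ε • W t) t)) - ε ^ 2 * (g.val (expMap g.leviCivita p (t • (v + (0 : ℝ) • w))) (g.leviCivita.curvature (expMap g.leviCivita p (t • (v + (0 : ℝ) • w))) (W t) (velocity I (fun t : ℝ ↦ expMap g.leviCivita p (t • (v + (0 : ℝ) • w))) t) (W t)) (velocity I (fun t : ℝ ↦ expMap g.leviCivita p (t • (v + (0 : ℝ) • w))) t) +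
          g.val (expMap g.leviCivita p (t • (v + (0 : ℝ) • w))) (covariantDerivAlong g.leviCivita (fun t : ℝ ↦ expMap g.leviCivita p (t • (v + (0 : ℝ) • w))) W t) (covariantDerivAlong g.leviCivita (fun t : ℝ ↦ expMap g.leviCivita p (t • (v + (0 : ℝ) • w))) W t))) t := by
    intro t
    have d1 : HasDerivAt (fun t ↦ g.val (expMap g.leviCivita p (t • (v + (0 : ℝ) • w))) (J' t) (J t))
        (g.val (expMap g.leviCivita p (t • (v + (0 : ℝ) • w))) (covariantDerivAlong g.leviCivita (fun t : ℝ ↦ expMap g.leviCivita p (t • (v + (0 : ℝ) • w))) J' t) (J t) + g.val (expMap g.leviCivita p (t • (v + (0 : ℝ) • w))) (J' t) (covariantDerivAlong g.leviCivita (fun t : ℝ ↦ expMap g.leviCivita p (t • (v + (0 : ℝ) • w))) J t)) t :=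
      g.hasDerivAt_val_apply_along hLC.2 (hJ'd t) (hJd t)
    rw [hJ't t] at d1
    have d2 : HasDerivAt (fun t ↦ g.val (expMap g.leviCivita p (t • (v + (0 : ℝ) • w))) (J' t) (W t))
        (g.val (expMap g.leviCivita p (t • (v + (0 : ℝ) • w))) (covariantDerivAlong g.leviCivita (fun t : ℝ ↦ expMap g.leviCivita p (t • (v + (0 : ℝ) • w))) J' t) (W t) + g.val (expMap g.leviCivita p (t • (v + (0 : ℝ) • w))) (J' t) (covariantDerivAlong g.leviCivita (fun t : ℝ ↦ expMap g.leviCivita p (t • (v + (0 : ℝ) • w))) W t)) t :=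
      g.hasDerivAt_val_apply_along hLC.2 (hJ'd t) (hWd t)
    refine (d1.add (d2.const_mul (2 * ε))).congr_deriv ?_
    rw [hJ''J t, hJ''W t, hpt1 t]
    ring
  -- integrate: `∫₀¹ q₁ = -2ε |J'(1)|² + ε² ∫₀¹ q_W`, `∫₁^s₀ q₂ = ε² ∫₁^s₀ q_W`
  have hIq₁ : IntervalIntegrable (fun t ↦ (g.val (expMap g.leviCivita p (t • (v + (0 : ℝ) • w))) (g.leviCivita.curvature (expMap g.leviCivita p (t • (v + (0 : ℝ) • w))) (J t + ε • W t) (velocity I (fun t : ℝ ↦ expMap g.leviCivita p (t • (v + (0 : ℝ) • w))) t) (J t + ε • W t)) (velocity I (fun t : ℝ ↦ expMap g.leviCivita p (t • (v + (0 : ℝ) • w))) t) +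
          g.val (expMap g.leviCivita p (t • (v + (0 : ℝ) • w))) (covariantDerivAlong g.leviCivita (fun t : ℝ ↦ expMap g.leviCivita p (t • (v + (0 : ℝ) • w))) (fun t ↦ J t + ε • W t) t) (covariantDerivAlong g.leviCivita (fun t : ℝ ↦ expMap g.leviCivita p (t • (v + (0 : ℝ) • w))) (fun t ↦ J t + ε • W t) t))) volume 0 1 := hq₁.intervalIntegrable 0 1
  have hIqW : IntervalIntegrable (fun t ↦ ε ^ 2 * (g.val (expMap g.leviCivita p (t • (v + (0 : ℝ) • w))) (g.leviCivita.curvature (expMap g.leviCivita p (t • (v + (0 : ℝ) • w))) (W t) (velocity I (fun t : ℝ ↦ expMap g.leviCivita p (t • (v + (0 : ℝ) • w))) t) (W t)) (velocity I (fun t : ℝ ↦ expMap g.leviCivita p (t • (v + (0 : ℝ) • w))) t) +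
          g.val (expMap g.leviCivita p (t • (v + (0 : ℝ) • w))) (covariantDerivAlong g.leviCivita (fun t : ℝ ↦ expMap g.leviCivita p (t • (v + (0 : ℝ) • w))) W t) (covariantDerivAlong g.leviCivita (fun t : ℝ ↦ expMap g.leviCivita p (t • (v + (0 : ℝ) • w))) W t))) volume 0 1 :=
    (continuous_const.mul hqW).intervalIntegrable 0 1
  have hFTC : ∫ t in (0 : ℝ)..1, ((g.val (expMap g.leviCivita p (t • (v + (0 : ℝ) • w))) (g.leviCivita.curvature (expMap g.leviCivita p (t • (v + (0 : ℝ) • w))) (J t + ε • W t) (velocity I (fun t : ℝ ↦ expMap g.leviCivita p (t • (v + (0 : ℝ) • w))) t) (J t + ε • W t)) (velocity I (fun t : ℝ ↦ expMap g.leviCivita p (t • (v + (0 : ℝ) • w))) t) +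
          g.val (expMap g.leviCivita p (t • (v + (0 : ℝ) • w))) (covariantDerivAlong g.leviCivita (fun t : ℝ ↦ expMap g.leviCivita p (t • (v + (0 : ℝ) • w))) (fun t ↦ J t + ε • W t) t) (covariantDerivAlong g.leviCivita (fun t : ℝ ↦ expMap g.leviCivita p (t • (v + (0 : ℝ) • w))) (fun t ↦ J t + ε • W t) t)) - ε ^ 2 * (g.val (expMap g.leviCivita p (t • (v + (0 : ℝ) • w))) (g.leviCivita.curvature (expMap g.leviCivita p (t • (v + (0 : ℝ) • w))) (W t) (velocity I (fun t : ℝ ↦ expMap g.leviCivita p (t • (v + (0 : ℝ) • w))) t) (W t)) (velocity I (fun t : ℝ ↦ expMap g.leviCivita p (t • (v + (0 : ℝ) • w))) t) +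
          g.val (expMap g.leviCivita p (t • (v + (0 : ℝ) • w))) (covariantDerivAlong g.leviCivita (fun t : ℝ ↦ expMap g.leviCivita p (t • (v + (0 : ℝ) • w))) W t) (covariantDerivAlong g.leviCivita (fun t : ℝ ↦ expMap g.leviCivita p (t • (v + (0 : ℝ) • w))) W t))) =
      (g.val (expMap g.leviCivita p ((1 : ℝ) • (v + (0 : ℝ) • w))) (J' 1) (J 1) + 2 * ε * g.val (expMap g.leviCivita p ((1 : ℝ) • (v + (0 : ℝ) • w))) (J' 1) (W 1)) -
      (g.val (expMap g.leviCivita p ((0 : ℝ) • (v + (0 : ℝ) • w))) (J' 0) (J 0) + 2 * ε * g.val (expMap g.leviCivita p ((0 : ℝ) • (v + (0 : ℝ) • w))) (J' 0) (W 0)) :=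
    intervalIntegral.integral_eq_sub_of_hasDerivAt (fun t _ ↦ hG t) (hIq₁.sub hIqW)
  have hbd : (g.val (expMap g.leviCivita p ((1 : ℝ) • (v + (0 : ℝ) • w))) (J' 1) (J 1) + 2 * ε * g.val (expMap g.leviCivita p ((1 : ℝ) • (v + (0 : ℝ) • w))) (J' 1) (W 1)) -
      (g.val (expMap g.leviCivita p ((0 : ℝ) • (v + (0 : ℝ) • w))) (J' 0) (J 0) + 2 * ε * g.val (expMap g.leviCivita p ((0 : ℝ) • (v + (0 : ℝ) • w))) (J' 0) (W 0)) =
      -(2 * ε * g.val (expMap g.leviCivita p ((1 : ℝ) • (v + (0 : ℝ) • w))) (J' 1) (J' 1)) := by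
    rw [hJ1, hJ0, hW1, hW0]
    simp only [map_zero, map_neg]
    ring
  have hI₁ : ∫ t in (0 : ℝ)..1, (g.val (expMap g.leviCivita p (t • (v + (0 : ℝ) • w))) (g.leviCivita.curvature (expMap g.leviCivita p (t • (v + (0 : ℝ) • w))) (J t + ε • W t) (velocity I (fun t : ℝ ↦ expMap g.leviCivita p (t • (v + (0 : ℝ) • w))) t) (J t + ε • W t)) (velocity I (fun t : ℝ ↦ expMap g.leviCivita p (t • (v + (0 : ℝ) • w))) t) +
          g.val (expMap g.leviCivita p (t • (v + (0 : ℝ) • w))) (covariantDerivAlong g.leviCivita (fun t : ℝ ↦ expMap g.leviCivita p (t • (v + (0 : ℝ) • w))) (fun t ↦ J t + ε • W t) t) (covariantDerivAlong g.leviCivita (fun t : ℝ ↦ expMap g.leviCivita p (t • (v + (0 : ℝ) • w))) (fun t ↦ J t + ε • W t) t)) =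
      -(2 * ε * g.val (expMap g.leviCivita p ((1 : ℝ) • (v + (0 : ℝ) • w))) (J' 1) (J' 1)) + ε ^ 2 * ∫ t in (0 : ℝ)..1, (g.val (expMap g.leviCivita p (t • (v + (0 : ℝ) • w))) (g.leviCivita.curvature (expMap g.leviCivita p (t • (v + (0 : ℝ) • w))) (W t) (velocity I (fun t : ℝ ↦ expMap g.leviCivita p (t • (v + (0 : ℝ) • w))) t) (W t)) (velocity I (fun t : ℝ ↦ expMap g.leviCivita p (t • (v + (0 : ℝ) • w))) t) +
          g.val (expMap g.leviCivita p (t • (v + (0 : ℝ) • w))) (covariantDerivAlong g.leviCivita (fun t : ℝ ↦ expMap g.leviCivita p (t • (v + (0 : ℝ) • w))) W t) (covariantDerivAlong g.leviCivita (fun t : ℝ ↦ expMap g.leviCivita p (t • (v + (0 : ℝ) • w))) W t)) := by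
    have h := intervalIntegral.integral_sub hIq₁ hIqW
    rw [hFTC, hbd, intervalIntegral.integral_const_mul] at h
    linarith
  have hI₂ : ∫ t in (1 : ℝ)..s₀, (g.val (expMap g.leviCivita p (t • (v + (0 : ℝ) • w))) (g.leviCivita.curvature (expMap g.leviCivita p (t • (v + (0 : ℝ) • w))) (ε • W t) (velocity I (fun t : ℝ ↦ expMap g.leviCivita p (t • (v + (0 : ℝ) • w))) t) (ε • W t)) (velocity I (fun t : ℝ ↦ expMap g.leviCivita p (t • (v + (0 : ℝ) • w))) t) +
          g.val (expMap g.leviCivita p (t • (v + (0 : ℝ) • w))) (covariantDerivAlong g.leviCivita (fun t : ℝ ↦ expMap g.leviCivita p (t • (v + (0 : ℝ) • w))) (fun t ↦ ε • W t) t) (covariantDerivAlong g.leviCivita (fun t : ℝ ↦ expMap g.leviCivita p (t • (v + (0 : ℝ) • w))) (fun t ↦ ε • W t) t)) = ε ^ 2 * ∫ t in (1 : ℝ)..s₀, (g.val (expMap g.leviCivita p (t • (v + (0 : ℝ) • w))) (g.leviCivita.curvature (expMap g.leviCivita p (t • (v + (0 : ℝ) • w))) (W t) (velocity I (fun t : ℝ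 ↦ expMap g.leviCivita p (t • (v + (0 : ℝ) • w))) t) (W t)) (velocity I (fun t : ℝ ↦ expMap g.leviCivita p (t • (v + (0 : ℝ) • w))) t) +
          g.val (expMap g.leviCivita p (t • (v + (0 : ℝ) • w))) (covariantDerivAlong g.leviCivita (fun t : ℝ ↦ expMap g.leviCivita p (t • (v + (0 : ℝ) • w))) W t) (covariantDerivAlong g.leviCivita (fun t : ℝ ↦ expMap g.leviCivita p (t • (v + (0 : ℝ) • w))) W t)) := by
    have hfun : (fun t ↦ (g.val (expMap g.leviCivita p (t • (v + (0 : ℝ) • w))) (g.leviCivita.curvature (expMap g.leviCivita p (t • (v + (0 : ℝ) • w))) (ε • W t) (velocity I (fun t : ℝ ↦ expMap g.leviCivita p (t • (v + (0 : ℝ) • w))) t) (ε • W t)) (velocity I (fun t : ℝ ↦ expMap g.leviCivita p (t • (v + (0 : ℝ) • w))) t) +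
          g.val (expMap g.leviCivita p (t • (v + (0 : ℝ) • w))) (covariantDerivAlong g.leviCivita (fun t : ℝ ↦ expMap g.leviCivita p (t • (v + (0 : ℝ) • w))) (fun t ↦ ε • W t) t) (covariantDerivAlong g.leviCivita (fun t : ℝ ↦ expMap g.leviCivita p (t • (v + (0 : ℝ) • w))) (fun t ↦ ε • W t) t))) = fun t ↦ ε ^ 2 * (g.val (expMap g.leviCivita p (t • (v + (0 : ℝ) • w))) (g.leviCivita.curvature (expMap g.leviCivita p (t • (v + (0 : ℝ) • w))) (W t) (velocity I (fun t : ℝ ↦ expMap g.leviCivita p (t • (v + (0 : ℝ) • w))) t) (W t)) (velocity I (fun t : ℝ ↦ expMap g.leviCivita p (t • (v + (0 : ℝ) • w))) t) +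
          g.val (expMap g.leviCivita p (t • (v + (0 : ℝ) • w))) (covariantDerivAlong g.leviCivita (fun t : ℝ ↦ expMap g.leviCivita p (t • (v + (0 : ℝ) • w))) W t) (covariantDerivAlong g.leviCivita (fun t : ℝ ↦ expMap g.leviCivita p (t • (v + (0 : ℝ) • w))) W t)) := funext hpt2
    rw [hfun]
    exact intervalIntegral.integral_const_mul _ _
  -- the choice of `ε` makes the total index negative
  have key : 0 ≤ -(2 * ε * g.val (expMap g.leviCivita p ((1 : ℝ) • (v + (0 : ℝ) • w))) (J' 1) (J' 1)) +
      ε ^ 2 * ((∫ t in (0 : ℝ)..1, (g.val (expMap g.leviCivita p (t • (v + (0 : ℝ) • w))) (g.leviCivita.curvature (expMap g.leviCivita p (t • (v + (0 : ℝ) • w))) (W t) (velocity I (fun t : ℝ ↦ expMap g.leviCivita p (t • (v + (0 : ℝ) • w))) t) (W t)) (velocity I (fun t : ℝ ↦ expMap g.leviCivita p (t • (v + (0 : ℝ) • w))) t) +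
          g.val (expMap g.leviCivita p (t • (v + (0 : ℝ) • w))) (covariantDerivAlong g.leviCivita (fun t : ℝ ↦ expMap g.leviCivita p (t • (v + (0 : ℝ) • w))) W t) (covariantDerivAlong g.leviCivita (fun t : ℝ ↦ expMap g.leviCivita p (t • (v + (0 : ℝ) • w))) W t))) + ∫ t in (1 : ℝ)..s₀, (g.val (expMap g.leviCivita p (t • (v + (0 : ℝ) • w))) (g.leviCivita.curvature (expMap g.leviCivita p (t • (v + (0 : ℝ) • w))) (W t) (velocity I (fun t : ℝ ↦ expMap g.leviCivita p (t • (v + (0 : ℝ) • w))) t) (W t)) (velocity I (fun t : ℝ ↦ expMap g.leviCivita p (t • (v + (0 : ℝ) • w))) t) +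
          g.val (expMap g.leviCivita p (t • (v + (0 : ℝ) • w))) (covariantDerivAlong g.leviCivita (fun t : ℝ ↦ expMap g.leviCivita p (t • (v + (0 : ℝ) • w))) W t) (covariantDerivAlong g.leviCivita (fun t : ℝ ↦ expMap g.leviCivita p (t • (v + (0 : ℝ) • w))) W t))) := by
    linarith [hind, hI₁, hI₂]
  have hC : ε * |(∫ t in (0 : ℝ)..1, (g.val (expMap g.leviCivita p (t • (v + (0 : ℝ) • w))) (g.leviCivita.curvature (expMap g.leviCivita p (t • (v + (0 : ℝ) • w))) (W t) (velocity I (fun t : ℝ ↦ expMap g.leviCivita p (t • (v + (0 : ℝ) • w))) t) (W t)) (velocity I (fun t : ℝ ↦ expMap g.leviCivita p (t • (v + (0 : ℝ) • w))) t) +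
          g.val (expMap g.leviCivita p (t • (v + (0 : ℝ) • w))) (covariantDerivAlong g.leviCivita (fun t : ℝ ↦ expMap g.leviCivita p (t • (v + (0 : ℝ) • w))) W t) (covariantDerivAlong g.leviCivita (fun t : ℝ ↦ expMap g.leviCivita p (t • (v + (0 : ℝ) • w))) W t))) + ∫ t in (1 : ℝ)..s₀, (g.val (expMap g.leviCivita p (t • (v + (0 : ℝ) • w))) (g.leviCivita.curvature (expMap g.leviCivita p (t • (v + (0 : ℝ) • w))) (W t) (velocity I (fun t : ℝ ↦ expMap g.leviCivita p (t • (v + (0 : ℝ) • w))) t) (W t)) (velocity I (fun t : ℝ ↦ expMap g.leviCivita p (t • (v + (0 : ℝ) • w))) t) +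
          g.val (expMap g.leviCivita p (t • (v + (0 : ℝ) • w))) (covariantDerivAlong g.leviCivita (fun t : ℝ ↦ expMap g.leviCivita p (t • (v + (0 : ℝ) • w))) W t) (covariantDerivAlong g.leviCivita (fun t : ℝ ↦ expMap g.leviCivita p (t • (v + (0 : ℝ) • w))) W t))| <
      g.val (expMap g.leviCivita p ((1 : ℝ) • (v + (0 : ℝ) • w))) (J' 1) (J' 1) := by
    rw [hε_def, div_mul_eq_mul_div, div_lt_iff₀ hden]
    nlinarith [abs_nonneg ((∫ t in (0 : ℝ)..1, (g.val (expMap g.leviCivita p (t • (v + (0 : ℝ) • w))) (g.leviCivita.curvature (expMap g.leviCivita p (t • (v + (0 : ℝ) • w))) (W t) (velocity I (fun t : ℝ ↦ expMap g.leviCivita p (t • (v + (0 : ℝ) • w))) t) (W t)) (velocity I (fun t : ℝ ↦ expMap g.leviCivita p (t • (v + (0 : ℝ) • w))) t) +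
          g.val (expMap g.leviCivita p (t • (v + (0 : ℝ) • w))) (covariantDerivAlong g.leviCivita (fun t : ℝ ↦ expMap g.leviCivita p (t • (v + (0 : ℝ) • w))) W t) (covariantDerivAlong g.leviCivita (fun t : ℝ ↦ expMap g.leviCivita p (t • (v + (0 : ℝ) • w))) W t))) + ∫ t in (1 : ℝ)..s₀, (g.val (expMap g.leviCivita p (t • (v + (0 : ℝ) • w))) (g.leviCivita.curvature (expMap g.leviCivita p (t • (v + (0 : ℝ) • w))) (W t) (velocity I (fun t : ℝ ↦ expMap g.leviCivita p (t • (v + (0 : ℝ) • w))) t) (W t)) (velocity I (fun t : ℝ ↦ expMap g.leviCivita p (t • (v + (0 : ℝ) • w))) t) +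
          g.val (expMap g.leviCivita p (t • (v + (0 : ℝ) • w))) (covariantDerivAlong g.leviCivita (fun t : ℝ ↦ expMap g.leviCivita p (t • (v + (0 : ℝ) • w))) W t) (covariantDerivAlong g.leviCivita (fun t : ℝ ↦ expMap g.leviCivita p (t • (v + (0 : ℝ) • w))) W t))),
      mul_pos hN hN]
  have h1 : ε ^ 2 * ((∫ t in (0 : ℝ)..1, (g.val (expMap g.leviCivita p (t • (v + (0 : ℝ) • w))) (g.leviCivita.curvature (expMap g.leviCivita p (t • (v + (0 : ℝ) • w))) (W t) (velocity I (fun t : ℝ ↦ expMap g.leviCivita p (t • (v + (0 : ℝ) • w))) t) (W t)) (velocity I (fun t : ℝ ↦ expMap g.leviCivita p (t • (v + (0 : ℝ) • w))) t) +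
          g.val (expMap g.leviCivita p (t • (v + (0 : ℝ) • w))) (covariantDerivAlong g.leviCivita (fun t : ℝ ↦ expMap g.leviCivita p (t • (v + (0 : ℝ) • w))) W t) (covariantDerivAlong g.leviCivita (fun t : ℝ ↦ expMap g.leviCivita p (t • (v + (0 : ℝ) • w))) W t))) + ∫ t in (1 : ℝ)..s₀, (g.val (expMap g.leviCivita p (t • (v + (0 : ℝ) • w))) (g.leviCivita.curvature (expMap g.leviCivita p (t • (v + (0 : ℝ) • w))) (W t) (velocity I (fun t : ℝ ↦ expMap g.leviCivita p (t • (v + (0 : ℝ) • w))) t) (W t)) (velocity I (fun t : ℝ ↦ expMap g.leviCivita p (t • (v + (0 : ℝ) • w))) t) +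
          g.val (expMap g.leviCivita p (t • (v + (0 : ℝ) • w))) (covariantDerivAlong g.leviCivita (fun t : ℝ ↦ expMap g.leviCivita p (t • (v + (0 : ℝ) • w))) W t) (covariantDerivAlong g.leviCivita (fun t : ℝ ↦ expMap g.leviCivita p (t • (v + (0 : ℝ) • w))) W t))) ≤
      ε ^ 2 * |(∫ t in (0 : ℝ)..1, (g.val (expMap g.leviCivita p (t • (v + (0 : ℝ) • w))) (g.leviCivita.curvature (expMap g.leviCivita p (t • (v + (0 : ℝ) • w))) (W t) (velocity I (fun t : ℝ ↦ expMap g.leviCivita p (t • (v + (0 : ℝ) • w))) t) (W t)) (velocity I (fun t : ℝ ↦ expMap g.leviCivita p (t • (v + (0 : ℝ) • w))) t) +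
          g.val (expMap g.leviCivita p (t • (v + (0 : ℝ) • w))) (covariantDerivAlong g.leviCivita (fun t : ℝ ↦ expMap g.leviCivita p (t • (v + (0 : ℝ) • w))) W t) (covariantDerivAlong g.leviCivita (fun t : ℝ ↦ expMap g.leviCivita p (t • (v + (0 : ℝ) • w))) W t))) + ∫ t in (1 : ℝ)..s₀, (g.val (expMap g.leviCivita p (t • (v + (0 : ℝ) • w))) (g.leviCivita.curvature (expMap g.leviCivita p (t • (v + (0 : ℝ) • w))) (W t) (velocity I (fun t : ℝ ↦ expMap g.leviCivita p (t • (v + (0 : ℝ) • w))) t) (W t)) (velocity I (fun t : ℝ ↦ expMap g.leviCivita p (t • (v + (0 : ℝ) • w))) t) +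
          g.val (expMap g.leviCivita p (t • (v + (0 : ℝ) • w))) (covariantDerivAlong g.leviCivita (fun t : ℝ ↦ expMap g.leviCivita p (t • (v + (0 : ℝ) • w))) W t) (covariantDerivAlong g.leviCivita (fun t : ℝ ↦ expMap g.leviCivita p (t • (v + (0 : ℝ) • w))) W t))| :=
    mul_le_mul_of_nonneg_left (le_abs_self _) (sq_nonneg ε)
  have h2 : ε ^ 2 * |(∫ t in (0 : ℝ)..1, (g.val (expMap g.leviCivita p (t • (v + (0 : ℝ) • w))) (g.leviCivita.curvature (expMap g.leviCivita p (t • (v + (0 : ℝ) • w))) (W t) (velocity I (fun t : ℝ ↦ expMap g.leviCivita p (t • (v + (0 : ℝ) • w))) t) (W t)) (velocity I (fun t : ℝ ↦ expMap g.leviCivita p (t • (v + (0 : ℝ) • w))) t) +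
          g.val (expMap g.leviCivita p (t • (v + (0 : ℝ) • w))) (covariantDerivAlong g.leviCivita (fun t : ℝ ↦ expMap g.leviCivita p (t • (v + (0 : ℝ) • w))) W t) (covariantDerivAlong g.leviCivita (fun t : ℝ ↦ expMap g.leviCivita p (t • (v + (0 : ℝ) • w))) W t))) + ∫ t in (1 : ℝ)..s₀, (g.val (expMap g.leviCivita p (t • (v + (0 : ℝ) • w))) (g.leviCivita.curvature (expMap g.leviCivita p (t • (v + (0 : ℝ) • w))) (W t) (velocity I (fun t : ℝ ↦ expMap g.leviCivita p (t • (v + (0 : ℝ) • w))) t) (W t)) (velocity I (fun t : ℝ ↦ expMap g.leviCivita p (t • (v + (0 : ℝ) • w))) t) +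
          g.val (expMap g.leviCivita p (t • (v + (0 : ℝ) • w))) (covariantDerivAlong g.leviCivita (fun t : ℝ ↦ expMap g.leviCivita p (t • (v + (0 : ℝ) • w))) W t) (covariantDerivAlong g.leviCivita (fun t : ℝ ↦ expMap g.leviCivita p (t • (v + (0 : ℝ) • w))) W t))| <
      ε * g.val (expMap g.leviCivita p ((1 : ℝ) • (v + (0 : ℝ) • w))) (J' 1) (J' 1) := by
    have h := mul_lt_mul_of_pos_left hC hε
    have e : ε ^ 2 * |(∫ t in (0 : ℝ)..1, (g.val (expMap g.leviCivita p (t • (v + (0 : ℝ) • w))) (g.leviCivita.curvature (expMap g.leviCivita p (t • (v + (0 : ℝ) • w))) (W t) (velocity I (fun t : ℝ ↦ expMap g.leviCivita p (t • (v + (0 : ℝ) • w))) t) (W t)) (velocity I (fun t : ℝ ↦ expMap g.leviCivita p (t • (v + (0 : ℝ) • w))) t) +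
          g.val (expMap g.leviCivita p (t • (v + (0 : ℝ) • w))) (covariantDerivAlong g.leviCivita (fun t : ℝ ↦ expMap g.leviCivita p (t • (v + (0 : ℝ) • w))) W t) (covariantDerivAlong g.leviCivita (fun t : ℝ ↦ expMap g.leviCivita p (t • (v + (0 : ℝ) • w))) W t))) + ∫ t in (1 : ℝ)..s₀, (g.val (expMap g.leviCivita p (t • (v + (0 : ℝ) • w))) (g.leviCivita.curvature (expMap g.leviCivita p (t • (v + (0 : ℝ) • w))) (W t) (velocity I (fun t : ℝ ↦ expMap g.leviCivita p (t • (v + (0 : ℝ) • w))) t) (W t)) (velocity I (fun t : ℝ ↦ expMap g.leviCivita p (t • (v + (0 : ℝ) • w))) t) +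
          g.val (expMap g.leviCivita p (t • (v + (0 : ℝ) • w))) (covariantDerivAlong g.leviCivita (fun t : ℝ ↦ expMap g.leviCivita p (t • (v + (0 : ℝ) • w))) W t) (covariantDerivAlong g.leviCivita (fun t : ℝ ↦ expMap g.leviCivita p (t • (v + (0 : ℝ) • w))) W t))| =
        ε * (ε * |(∫ t in (0 : ℝ)..1, (g.val (expMap g.leviCivita p (t • (v + (0 : ℝ) • w))) (g.leviCivita.curvature (expMap g.leviCivita p (t • (v + (0 : ℝ) • w))) (W t) (velocity I (fun t : ℝ ↦ expMap g.leviCivita p (t • (v + (0 : ℝ) • w))) t) (W t)) (velocity I (fun t : ℝ ↦ expMap g.leviCivita p (t • (v + (0 : ℝ) • w))) t) +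
          g.val (expMap g.leviCivita p (t • (v + (0 : ℝ) • w))) (covariantDerivAlong g.leviCivita (fun t : ℝ ↦ expMap g.leviCivita p (t • (v + (0 : ℝ) • w))) W t) (covariantDerivAlong g.leviCivita (fun t : ℝ ↦ expMap g.leviCivita p (t • (v + (0 : ℝ) • w))) W t))) + ∫ t in (1 : ℝ)..s₀, (g.val (expMap g.leviCivita p (t • (v + (0 : ℝ) • w))) (g.leviCivita.curvature (expMap g.leviCivita p (t • (v + (0 : ℝ) • w))) (W t) (velocity I (fun t : ℝ ↦ expMap g.leviCivita p (t • (v + (0 : ℝ) • w))) t) (W t)) (velocity I (fun t : ℝ ↦ expMap g.leviCivita p (t • (v + (0 : ℝ) • w))) t) +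
          g.val (expMap g.leviCivita p (t • (v + (0 : ℝ) • w))) (covariantDerivAlong g.leviCivita (fun t : ℝ ↦ expMap g.leviCivita p (t • (v + (0 : ℝ) • w))) W t) (covariantDerivAlong g.leviCivita (fun t : ℝ ↦ expMap g.leviCivita p (t • (v + (0 : ℝ) • w))) W t))|) := by ring
    rw [e]
    exact h
  linarith [key, h1, h2, mul_pos hε hN]

end Literature.Geometry.Riemannian

end
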